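import Mathlib

/-!
# Route BarrierLever — item `PartitionMinorsHitByVP` (stmt-ValiantsHypothesis-19717), line `hidden-states`:
# THE EXCHANGE (PLÜCKER) COMPOSITION OF FIRST-SHELL CERTIFICATES — «two first-shell tables + one vanishing cross minor
# ⇒ a second-shell table»

Helper file (`--supports stmt-ValiantsHypothesis-19717`; cell valiant-natproofs, 𝒟-side door (c), registered line
`Cruxes/PartitionMinorsHitByVP/Lines/hidden_states.lean` v8; prover seat val-np-p6 gen 17).  Closes NO item; definition-free
apart from two transparent abbreviations (`mat`, `tab2`).

THE MECHANISM (memo HOME/val-np-p6/g17/MEMO-valnp6-g17.md §1).  For a table `w` («coordinate `a` of the hidden point of `J` is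
`Σ_{q ∈ J} w a q`») write `D_V(w)` for the determinant of the monomial rows `V` against the points.  For a row enumeration `b`
and two slots `i₁ ≠ i₂` holding `A₁, A₂`, the three-term exchange identity
  `D_B · D_{B − A₁ − A₂ + C₁ + C₂} = D_{B − A₁ + C₁} · D_{B − A₂ + C₂} − D_{B − A₁ + C₂} · D_{B − A₂ + C₁}`
(`det_mul_det_updateRow_updateRow`, Cramer's rule in one row followed by a determinantal functional; any commutative
ring) is applied to the TWO-PARAMETER table `T(ε) = I + ε₀ N₁ + ε₁ N₂` with entries in `ℂ[ε₀, ε₁]`.  If one CROSS minor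
vanishes for every `ε` while `D_{B − A₁ + C₁} ≠ 0` at `ε = (1,0)` and `D_{B − A₂ + C₂} ≠ 0` at `ε = (0,1)` (two FIRST-SHELL
certificates, each for its own table), then `D_B · D_U` is a product of two nonzero polynomials, hence `D_U(ε) ≠ 0` for some
`ε ∈ ℂ²` (★ `exists_params_of_cross_zero`; item-currency form ★ `exists_table_of_cross_zero`).  No unipotence / acyclicity of the
combined table is needed.  The sibling file `…SecondShellTrapped` supplies the cross-minor vanishing (trapped tokens, unfed targets),
`…SecondShellCells` the cells.

WHAT THIS IS NOT: no statement about which second-shell classes admit a vanishing cross minor (see the cells file and the memo's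
census); nothing on crux 14610 or VP ≠ VNP.
-/

set_option linter.dupNamespace false

namespace Summit.ValiantsHypothesis.ValiantsHypothesis.Theorems.BarrierLever.HiddenStates

open Finset

noncomputable section

namespace SecondShell

/-! ## The two-row exchange identity (three-term Plücker relation), any commutative ring -/

section Exchange

variable {R : Type*} [CommRing R] {n : Type*} [Fintype n] [DecidableEq n]

/-- `det` along a finite linear combination placed in one row. -/
theorem det_updateRow_sum' {κ : Type*} (s : Finset κ) (M : Matrix n n R) (i : n) (c : κ → R) (v : κ → n → R) :
    (M.updateRow i (∑ t ∈ s, c t • v t)).det = ∑ t ∈ s, c t * (M.updateRow i (v t)).det := by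
  classical
  induction s using Finset.induction_on with
  | empty =>
    rw [Finset.sum_empty, Finset.sum_empty]
    exact Matrix.det_eq_zero_of_row_eq_zero i fun j => by rw [Matrix.updateRow_self]; rfl
  | @insert a s ha ih =>
    rw [Finset.sum_insert ha, Finset.sum_insert ha, Matrix.det_updateRow_add, Matrix.det_updateRow_smul, ih]

/-- **Cramer's rule in row form**: `det M • c = Σ_t det(M[t ↦ c]) • M t`. -/
theorem det_smul_eq_sum_updateRow (M : Matrix n n R) (c : n → R) :
    M.det • c = ∑ t, (M.updateRow t c).det • M t := by
  have h := Matrix.mulVec_cramer M.transpose c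
  rw [Matrix.det_transpose] at h
  rw [← h]
  funext k
  simp only [Matrix.mulVec, dotProduct, Matrix.transpose_apply, Finset.sum_apply, Pi.smul_apply, smul_eq_mul,
    Matrix.cramer_transpose_apply]
  exact Finset.sum_congr rfl fun t _ => mul_comm _ _

/-- ★ **The two-row exchange identity** (three-term Plücker relation): for `i ≠ j` and row vectors `c, c'`,
`det M · det(M[i ↦ c][j ↦ c']) = det(M[i ↦ c]) · det(M[j ↦ c']) − det(M[i ↦ c']) · det(M[j ↦ c])`. -/
theorem det_mul_det_updateRow_updateRow (M : Matrix n n R) {i j : n} (hij : i ≠ j) (c c' : n → R) :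
    M.det * ((M.updateRow i c).updateRow j c').det =
      (M.updateRow i c).det * (M.updateRow j c').det - (M.updateRow i c').det * (M.updateRow j c).det := by
  classical
  set N := M.updateRow j c' with hN
  -- the functional `w ↦ det (N[i ↦ w])` applied to Cramer's identity
  have h1 : (N.updateRow i (M.det • c)).det = M.det * ((M.updateRow i c).updateRow j c').det := by
    rw [Matrix.det_updateRow_smul, hN, Matrix.updateRow_comm _ hij.symm]
  have h2 : (N.updateRow i (M.det • c)).det = ∑ t, (M.updateRow t c).det * (N.updateRow i (M t)).det := by
    rw [det_smul_eq_sum_updateRow M c]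
    exact det_updateRow_sum' Finset.univ N i (fun t => (M.updateRow t c).det) (fun t => M t)
  -- only `t = i` and `t = j` survive
  have hvan : ∀ t, t ≠ i → t ≠ j → (N.updateRow i (M t)).det = 0 := by
    intro t hti htj
    refine Matrix.det_zero_of_row_eq (i := i) (j := t) (Ne.symm hti) ?_
    rw [Matrix.updateRow_self, Matrix.updateRow_ne hti, hN, Matrix.updateRow_ne htj]
  have hi : (N.updateRow i (M i)).det = (M.updateRow j c').det := by
    have : N.updateRow i (M i) = N := by
      have hNi : N i = M i := by rw [hN, Matrix.updateRow_ne hij]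
      rw [← hNi, Matrix.updateRow_eq_self]
    rw [this]
  have hj : (N.updateRow i (M j)).det = -(M.updateRow i c').det := by
    have hswap : (N.updateRow i (M j)).submatrix (Equiv.swap i j) id = M.updateRow i c' := by
      ext k l
      rw [Matrix.submatrix_apply, id]
      by_cases hki : k = i
      · subst hki
        rw [Equiv.swap_apply_left, Matrix.updateRow_ne hij.symm, hN, Matrix.updateRow_self, Matrix.updateRow_self]
      · by_cases hkj : k = j
        · subst hkj
          rw [Equiv.swap_apply_right, Matrix.updateRow_self, Matrix.updateRow_ne hki]
        · rw [Equiv.swap_apply_of_ne_of_ne hki hkj, Matrix.updateRow_ne hki, hN, Matrix.updateRow_ne hkj,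
            Matrix.updateRow_ne hki]
    have hdet := Matrix.det_permute (Equiv.swap i j) (N.updateRow i (M j))
    rw [hswap, Equiv.Perm.sign_swap hij] at hdet
    rw [hdet]; simp
  rw [← h1, h2, ← Finset.sum_subset (Finset.subset_univ {i, j})]
  · rw [Finset.sum_pair hij, hi, hj]; ring
  · intro t _ ht
    rw [Finset.mem_insert, Finset.mem_singleton, not_or] at ht
    rw [hvan t ht.1 ht.2, mul_zero]

end Exchange

/-! ## The monomial matrix of a table, and the two-parameter table -/

variable {ι : Type} [Fintype ι] [DecidableEq ι]

/-- the monomial matrix of the row family `u` against the column points `colJ` for the table `w`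
(entry `∏_{a ∈ u i} Σ_{q ∈ colJ kk} w a q`). -/
abbrev mat {S : Type*} [CommRing S] (w : ι → ι → S) {r : ℕ} (u colJ : Fin r → Finset ι) : Matrix (Fin r) (Fin r) S :=
  Matrix.of fun i kk => ∏ a ∈ u i, ∑ q ∈ colJ kk, w a q

/-- the two-parameter table `I + ε₀ N₁ + ε₁ N₂`. -/
abbrev tab2 (N₁ N₂ : ι → ι → ℂ) (ε : Fin 2 → ℂ) : ι → ι → ℂ :=
  fun a q => (if q = a then 1 else 0) + ε 0 * N₁ a q + ε 1 * N₂ a q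

/-- the same table with generic parameters, entries in `ℂ[ε₀, ε₁]`. -/
abbrev tabR (N₁ N₂ : ι → ι → ℂ) : ι → ι → MvPolynomial (Fin 2) ℂ :=
  fun a q => MvPolynomial.C (if q = a then 1 else 0) + MvPolynomial.X 0 * MvPolynomial.C (N₁ a q) +
    MvPolynomial.X 1 * MvPolynomial.C (N₂ a q)

omit [Fintype ι] [DecidableEq ι] in
/-- replacing one row set replaces one row. -/
theorem mat_update {S : Type*} [CommRing S] (w : ι → ι → S) {r : ℕ} (u colJ : Fin r → Finset ι) (i : Fin r)
    (C : Finset ι) :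
    mat w (Function.update u i C) colJ = (mat w u colJ).updateRow i (fun kk => ∏ a ∈ C, ∑ q ∈ colJ kk, w a q) := by
  ext i' kk
  simp only [mat, Matrix.of_apply, Matrix.updateRow_apply]
  by_cases h : i' = i
  · subst h; simp
  · rw [Function.update_of_ne h, if_neg h]

omit [Fintype ι] in
/-- evaluation of the generic determinant. -/
theorem eval_det_mat_tabR (N₁ N₂ : ι → ι → ℂ) {r : ℕ} (u colJ : Fin r → Finset ι) (ε : Fin 2 → ℂ) :
    MvPolynomial.eval ε (mat (tabR N₁ N₂) u colJ).det = (mat (tab2 N₁ N₂ ε) u colJ).det := by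
  rw [RingHom.map_det, RingHom.mapMatrix_apply]
  congr 1
  ext i kk
  simp only [mat, Matrix.map_apply, Matrix.of_apply, map_prod, map_sum, tabR, tab2, map_add, map_mul,
    MvPolynomial.eval_C, MvPolynomial.eval_X]

/-! ## ★ The composition theorem -/

omit [Fintype ι] in
/-- ★ **EXCHANGE COMPOSITION.**  Row enumeration `b` (the ball), slots `i₁ ≠ i₂` (holding `A₁, A₂`), new rows `C₁, C₂`;
two-parameter table `I + ε₀N₁ + ε₁N₂`.  If the first-shell minor `D_{B−A₁+C₁}` is nonzero for the table `I + N₁`, the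
first-shell minor `D_{B−A₂+C₂}` is nonzero for `I + N₂`, and one cross minor (`D_{B−A₁+C₂}` or `D_{B−A₂+C₁}`) vanishes
for EVERY parameter, then the second-shell determinant `D_{B−A₁−A₂+C₁+C₂}` is nonzero for SOME parameter. -/
theorem exists_params_of_cross_zero (N₁ N₂ : ι → ι → ℂ) {r : ℕ} (b colJ : Fin r → Finset ι) {i₁ i₂ : Fin r}
    (hne : i₁ ≠ i₂) (C₁ C₂ : Finset ι)
    (hF1 : (mat (tab2 N₁ N₂ ![1, 0]) (Function.update b i₁ C₁) colJ).det ≠ 0)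
    (hF2 : (mat (tab2 N₁ N₂ ![0, 1]) (Function.update b i₂ C₂) colJ).det ≠ 0)
    (hZ : (∀ ε, (mat (tab2 N₁ N₂ ε) (Function.update b i₁ C₂) colJ).det = 0) ∨
      (∀ ε, (mat (tab2 N₁ N₂ ε) (Function.update b i₂ C₁) colJ).det = 0)) :
    ∃ ε : Fin 2 → ℂ, (mat (tab2 N₁ N₂ ε) (Function.update (Function.update b i₁ C₁) i₂ C₂) colJ).det ≠ 0 := by
  classical
  -- everything over `ℂ[ε₀, ε₁]`
  set w := tabR N₁ N₂ with hw
  set M := mat w b colJ with hM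
  set c₁ : Fin r → MvPolynomial (Fin 2) ℂ := fun kk => ∏ a ∈ C₁, ∑ q ∈ colJ kk, w a q with hc₁
  set c₂ : Fin r → MvPolynomial (Fin 2) ℂ := fun kk => ∏ a ∈ C₂, ∑ q ∈ colJ kk, w a q with hc₂
  have hU : mat w (Function.update (Function.update b i₁ C₁) i₂ C₂) colJ = (M.updateRow i₁ c₁).updateRow i₂ c₂ := by
    rw [mat_update, mat_update]
  have h11 : mat w (Function.update b i₁ C₁) colJ = M.updateRow i₁ c₁ := mat_update _ _ _ _ _
  have h22 : mat w (Function.update b i₂ C₂) colJ = M.updateRow i₂ c₂ := mat_update _ _ _ _ _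
  have h12 : mat w (Function.update b i₁ C₂) colJ = M.updateRow i₁ c₂ := mat_update _ _ _ _ _
  have h21 : mat w (Function.update b i₂ C₁) colJ = M.updateRow i₂ c₁ := mat_update _ _ _ _ _
  have hex := det_mul_det_updateRow_updateRow M hne c₁ c₂
  -- the cross term vanishes identically
  have hcross : (M.updateRow i₁ c₂).det * (M.updateRow i₂ c₁).det = 0 := by
    rcases hZ with hZ | hZ
    · have : (M.updateRow i₁ c₂).det = 0 := by
        apply MvPolynomial.funext
        intro ε
        rw [map_zero, ← h12, hw, eval_det_mat_tabR]
        exact hZ ε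
      rw [this, zero_mul]
    · have : (M.updateRow i₂ c₁).det = 0 := by
        apply MvPolynomial.funext
        intro ε
        rw [map_zero, ← h21, hw, eval_det_mat_tabR]
        exact hZ ε
      rw [this, mul_zero]
  rw [hcross, sub_zero] at hex
  -- the two first-shell factors are nonzero polynomials
  have hP1 : (M.updateRow i₁ c₁).det ≠ 0 := by
    intro h0
    apply hF1
    rw [← eval_det_mat_tabR, ← hw, h11, h0, map_zero]
  have hP2 : (M.updateRow i₂ c₂).det ≠ 0 := by
    intro h0
    apply hF2
    rw [← eval_det_mat_tabR, ← hw, h22, h0, map_zero]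
  have hPU : ((M.updateRow i₁ c₁).updateRow i₂ c₂).det ≠ 0 := by
    intro h0
    rw [h0, mul_zero] at hex
    exact mul_ne_zero hP1 hP2 hex.symm
  -- a nonzero polynomial has a nonzero value
  by_contra hall
  push Not at hall
  apply hPU
  rw [← hU]
  apply MvPolynomial.funext
  intro ε
  rw [map_zero, hw, eval_det_mat_tabR]
  exact hall ε

omit [Fintype ι] in
/-- ★ **Item-currency form.**  Under the hypotheses of `exists_params_of_cross_zero`, the row family
`b[i₁ ↦ C₁][i₂ ↦ C₂]` is served by a table `tx : Option ι → ι → ℂ` (zero base point). -/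
theorem exists_table_of_cross_zero (N₁ N₂ : ι → ι → ℂ) {r : ℕ} (b colJ : Fin r → Finset ι) {i₁ i₂ : Fin r}
    (hne : i₁ ≠ i₂) (C₁ C₂ : Finset ι)
    (hF1 : (mat (tab2 N₁ N₂ ![1, 0]) (Function.update b i₁ C₁) colJ).det ≠ 0)
    (hF2 : (mat (tab2 N₁ N₂ ![0, 1]) (Function.update b i₂ C₂) colJ).det ≠ 0)
    (hZ : (∀ ε, (mat (tab2 N₁ N₂ ε) (Function.update b i₁ C₂) colJ).det = 0) ∨
      (∀ ε, (mat (tab2 N₁ N₂ ε) (Function.update b i₂ C₁) colJ).det = 0)) :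
    ∃ tx : Option ι → ι → ℂ,
      (Matrix.of fun i kk : Fin r => ∏ a ∈ Function.update (Function.update b i₁ C₁) i₂ C₂ i,
        (tx none a + ∑ q ∈ colJ kk, tx (some q) a)).det ≠ 0 := by
  obtain ⟨ε, hε⟩ := exists_params_of_cross_zero N₁ N₂ b colJ hne C₁ C₂ hF1 hF2 hZ
  refine ⟨fun o a => match o with | none => 0 | some q => tab2 N₁ N₂ ε a q, ?_⟩
  simpa [mat, zero_add] using hε

end SecondShell

end

end Summit.ValiantsHypothesis.ValiantsHypothesis.Theorems.BarrierLever.HiddenStates
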